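import Summits.HodgeConjecture.CorCM.Census.DicyclicTwistGenerate

/-!
# The dicyclic twist `Dic(A) ⊃ ℤ/2 × A`, X: blocks (the `G`-orbits of labels), their invariants, and three distinct residual blocks

COR-CM (cell `pub-hodgecm2`, stage 2 of the Hodge ladder), count-neutral KERNEL COMBINATORICS by the binder seat b23 (gen 42; claim
DICYCLIC-COLUMN, HOME/INBOX.md l.10328): part X of the lane `DicyclicTwist*`.  Bookkeeping definitions with bodies (`blockSetoid`, `Block`, `blk`,
`potB`, `nu`) + theorems on top of parts I–IX; no `decide` table, no certificate, no named fact, no geometry, no `sorry`.  `Interfaces.lean`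
(C1), every E term, B01, `Transposition/*`, `PortJoin/*` untouched.
HONEST FRAMING: `HC_CM` is NOT proved, here or anywhere in the tree; nothing here is a period, a count of record or a headline.

CONTENT.  §1 The motions `twH g` and `twH g ∘ twX` form a group (the image of `Dic(A)`), so **reachability** (some motion maps
`Ψ` to `Ψ'`) is an equivalence relation (`blockSetoid`); its classes are the BLOCKS (`Block A`, a `Fintype`; `β(G) = #Block A` is the number of
isogeny classes of simple factors in the census dictionary).  §2 Block invariants: the potential (`pot_eq_of_reach`) and, on labels of
potential `1`, the parity `nu = [cls ψ₀ = 0] + [ψ₀, ψ₁ in the same half] (mod 2)` (`nu_eq_of_reach`).  §3 The labels `(0,0)`, `(0, δ t)`,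
`(0, 1 + δ t)` lie in THREE DISTINCT BLOCKS (`three_residual_blocks`) — the residual blocks of the design note; hence the non-residual blocks
number at most `β − 3` (`card_nonresidual_add_three_le`).  Part XI attaches one reducing face to each non-residual block and counts the
generating family: `β − 1` faces.  All [folklore].

## References
* [Milne1999] J. S. Milne, Lefschetz motives and the Tate conjecture, Compositio Math. 117 (1999), Prop. 2.1, p. 54.
-/

namespace Summit.HodgeConjecture.CorCM.Census.DicyclicTwist

open Finset
open Summit.HodgeConjecture.CorCM.Census.OddSliceFacesModel
open Summit.HodgeConjecture.CorCM.Census.OddSliceFacesSquares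
open Summit.HodgeConjecture.CorCM.Census.OddSliceFacesDescent
open Summit.HodgeConjecture.CorCM.Census.EvenSliceFacesDescent

variable (A : Type) [AddCommGroup A] [Fintype A] [DecidableEq A]

/-! ## §1 Reachability and blocks -/

omit [DecidableEq A] [Fintype A] in
/-- Reachability is reflexive. [folklore] -/
theorem reach_refl (Ψ : Ty₂ A) : (∃ g : ZMod 2 × A, twH A g Ψ = Ψ ∨ twH A g (twX A Ψ) = Ψ) := ⟨0, Or.inl (twH_zero A Ψ)⟩

omit [DecidableEq A] [Fintype A] in
/-- `x⁻¹ = c·x`: `twXinv = twX ∘ twH c`… in the form `twX (twH (1,0) (twX Ψ)) = Ψ`. [folklore] -/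
theorem twX_twH_twX (Ψ : Ty₂ A) : twX A (twH A (1, 0) (twX A Ψ)) = Ψ := by
  rw [twX_twH, twX_twX, twH_twH]
  have : ((1 : ZMod 2), (0 : A)) + ((1 : ZMod 2), -(0 : A)) = 0 := by
    ext
    · exact (by decide : (1 : ZMod 2) + 1 = 0)
    · simp
  rw [this, twH_zero]

omit [DecidableEq A] [Fintype A] in
/-- Reachability is symmetric. [folklore] -/
theorem reach_symm {Ψ Ψ' : Ty₂ A} (h : (∃ g : ZMod 2 × A, twH A g Ψ = Ψ' ∨ twH A g (twX A Ψ) = Ψ')) :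
    (∃ g : ZMod 2 × A, twH A g Ψ' = Ψ ∨ twH A g (twX A Ψ') = Ψ) := by
  obtain ⟨g, h | h⟩ := h
  · refine ⟨-g, Or.inl ?_⟩
    rw [← h, twH_twH, add_neg_cancel, twH_zero]
  · have h' : twH A (-g) Ψ' = twX A Ψ := by rw [← h, twH_twH, add_neg_cancel, twH_zero]
    refine ⟨((-g + (1, 0)).1, -(-g + (1, 0)).2), Or.inr ?_⟩
    rw [← twX_twH, ← twH_twH, h', twX_twH_twX]

omit [DecidableEq A] [Fintype A] in
/-- Reachability is transitive. [folklore] -/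
theorem reach_trans {Ψ₁ Ψ₂ Ψ₃ : Ty₂ A} (h₁ : (∃ g : ZMod 2 × A, twH A g Ψ₁ = Ψ₂ ∨ twH A g (twX A Ψ₁) = Ψ₂))
    (h₂ : (∃ g : ZMod 2 × A, twH A g Ψ₂ = Ψ₃ ∨ twH A g (twX A Ψ₂) = Ψ₃)) :
    (∃ g : ZMod 2 × A, twH A g Ψ₁ = Ψ₃ ∨ twH A g (twX A Ψ₁) = Ψ₃) := by
  obtain ⟨g, hg⟩ := h₁
  obtain ⟨h, hh⟩ := h₂
  rcases hg with hg | hg <;> rcases hh with hh | hh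
  · exact ⟨g + h, Or.inl (by rw [← twH_twH, hg, hh])⟩
  · refine ⟨(g.1, -g.2) + h, Or.inr ?_⟩
    rw [← twH_twH, ← twX_twH, hg, hh]
  · exact ⟨g + h, Or.inr (by rw [← twH_twH, hg, hh])⟩
  · -- h·x·(g·x·Ψ₁) = h·(g.1,−g.2)·x·x·Ψ₁ = (h + (g.1,−g.2) + c)·Ψ₁
    refine ⟨((1 : ZMod 2), (0 : A)) + ((g.1, -g.2) + h), Or.inl ?_⟩
    rw [← hh, ← hg, twX_twH, twX_twX, twH_twH, twH_twH]

/-- **The block relation** (an equivalence). [folklore] -/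
def blockSetoid : Setoid (Ty₂ A) where
  r Ψ Ψ' := ∃ g : ZMod 2 × A, twH A g Ψ = Ψ' ∨ twH A g (twX A Ψ) = Ψ'
  iseqv := ⟨reach_refl A, fun h => reach_symm A h, fun h₁ h₂ => reach_trans A h₁ h₂⟩

/-- Reachability is decidable. [folklore] -/
instance : DecidableRel (blockSetoid A).r := fun Ψ Ψ' =>
  inferInstanceAs (Decidable (∃ g : ZMod 2 × A, twH A g Ψ = Ψ' ∨ twH A g (twX A Ψ) = Ψ'))

/-- **The blocks**: the orbits of `Dic(A)` on the labels. [folklore] -/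
def Block : Type := Quotient (blockSetoid A)

/-- The blocks form a finite type. [folklore] -/
noncomputable instance : Fintype (Block A) := Quotient.fintype (blockSetoid A)

/-- The block of a label. [folklore] -/
def blk (Ψ : Ty₂ A) : Block A := Quotient.mk (blockSetoid A) Ψ

omit [DecidableEq A] [Fintype A] in
/-- Two labels have the same block iff they are reachable from each other. [folklore] -/
theorem blk_eq_blk_iff (Ψ Ψ' : Ty₂ A) :
    blk A Ψ = blk A Ψ' ↔ (∃ g : ZMod 2 × A, twH A g Ψ = Ψ' ∨ twH A g (twX A Ψ) = Ψ') := Quotient.eq (r := blockSetoid A)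

/-! ## §2 Block invariants -/

omit [DecidableEq A] in
/-- **The potential is a block invariant.** [folklore] -/
theorem pot_eq_of_reach {Ψ Ψ' : Ty₂ A} (h : (∃ g : ZMod 2 × A, twH A g Ψ = Ψ' ∨ twH A g (twX A Ψ) = Ψ')) : pot A Ψ = pot A Ψ' := by
  obtain ⟨g, h | h⟩ := h
  · rw [← h, pot_twH]
  · rw [← h, pot_twH, pot_twX]

/-- The potential of a block. [folklore] -/
def potB (B : Block A) : ℕ := Quotient.liftOn B (pot A) fun _ _ h => pot_eq_of_reach A h

omit [DecidableEq A] in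
/-- `potB (blk Ψ) = pot Ψ`. [folklore] -/
@[simp] theorem potB_blk (Ψ : Ty₂ A) : potB A (blk A Ψ) = pot A Ψ := rfl

/-- The residual parity `ν = [cls ψ₀ = 0] + [ψ₀ low] + [ψ₁ low]` (mod 2). [folklore] -/
def nu (Ψ : Ty₂ A) : ZMod 2 :=
  (if clsTy A Ψ.1 = 0 then 1 else 0) + (if wt A Ψ.1 ≤ Fintype.card A / 2 then 1 else 0) +
    (if wt A Ψ.2 ≤ Fintype.card A / 2 then 1 else 0)

omit [AddCommGroup A] [DecidableEq A] in
/-- Conjugation flips the half indicator (mod 2, `|A|` odd). [folklore] -/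
theorem lowZ_compl (hA : Odd (Fintype.card A)) (ψ : Ty A) :
    (if Fintype.card A - wt A ψ ≤ Fintype.card A / 2 then (1 : ZMod 2) else 0) =
      (if wt A ψ ≤ Fintype.card A / 2 then (1 : ZMod 2) else 0) + 1 := by
  have hodd : Fintype.card A % 2 = 1 := Nat.odd_iff.mp hA
  have hw := wt_le A ψ
  have h11 : (1 : ZMod 2) + 1 = 0 := by decide
  by_cases h : wt A ψ ≤ Fintype.card A / 2
  · rw [if_pos h, if_neg (by omega), h11]
  · rw [if_neg h, if_pos (by omega), zero_add]

omit [DecidableEq A] in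
/-- `ν` is invariant under the diagonal motions (`|A|` odd). [folklore] -/
theorem nu_twH (hA : Odd (Fintype.card A)) (g : ZMod 2 × A) (Ψ : Ty₂ A) : nu A (twH A g Ψ) = nu A Ψ := by
  obtain ⟨a, t⟩ := g
  have h01 : ∀ u : ZMod 2, u = 0 ∨ u = 1 := by decide
  unfold nu twH
  simp only [clsTy_tw]
  rcases h01 a with rfl | rfl
  · simp only [wt_tw_zero]
  · simp only [wt_tw_one, lowZ_compl A hA]
    generalize (if clsTy A Ψ.1 = 0 then (1 : ZMod 2) else 0) = x
    generalize (if wt A Ψ.1 ≤ Fintype.card A / 2 then (1 : ZMod 2) else 0) = y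
    generalize (if wt A Ψ.2 ≤ Fintype.card A / 2 then (1 : ZMod 2) else 0) = z
    revert x y z; decide

omit [DecidableEq A] in
/-- `ν` is invariant under the swap-twist on labels of potential `1` (`|A|` odd). [folklore] -/
theorem nu_twX (hA : Odd (Fintype.card A)) {Ψ : Ty₂ A} (hp : pot A Ψ = 1) : nu A (twX A Ψ) = nu A Ψ := by
  obtain ⟨a, b⟩ := Ψ
  have h11 : (1 : ZMod 2) + 1 = 0 := by decide
  unfold pot at hp
  simp only at hp
  have hc : (if clsTy A b = 0 then (1 : ZMod 2) else 0) = (if clsTy A a = 0 then (1 : ZMod 2) else 0) + 1 := by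
    by_cases h : clsTy A a = 0
    · rw [if_pos h, if_neg (by omega), h11]
    · rw [if_neg h, if_pos (by omega), zero_add]
  unfold nu twX
  simp only [clsTy_rev, wt_add_one, wt_rev, lowZ_compl A hA, hc]
  generalize (if clsTy A a = 0 then (1 : ZMod 2) else 0) = x
  generalize (if wt A a ≤ Fintype.card A / 2 then (1 : ZMod 2) else 0) = y
  generalize (if wt A b ≤ Fintype.card A / 2 then (1 : ZMod 2) else 0) = z
  revert x y z; decide

omit [DecidableEq A] in
/-- **`ν` is a block invariant on the labels of potential `1`.** [folklore] -/
theorem nu_eq_of_reach (hA : Odd (Fintype.card A)) {Ψ Ψ' : Ty₂ A} (hp : pot A Ψ = 1)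
    (h : (∃ g : ZMod 2 × A, twH A g Ψ = Ψ' ∨ twH A g (twX A Ψ) = Ψ')) : nu A Ψ = nu A Ψ' := by
  obtain ⟨g, h | h⟩ := h
  · rw [← h, nu_twH A hA]
  · rw [← h, nu_twH A hA, nu_twX A hA hp]

/-! ## §3 Three distinct residual blocks -/

omit [AddCommGroup A] in
/-- The potential of the three residual representatives. [folklore] -/
theorem pot_residual (h3 : 3 ≤ Fintype.card A) (t : A) :
    pot A ((0 : Ty A), (0 : Ty A)) = 0 ∧ pot A ((0 : Ty A), δ A t) = 1 ∧ pot A ((0 : Ty A), 1 + δ A t) = 1 := by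
  have hw1 : wt A (1 : Ty A) = Fintype.card A := by
    have := wt_add_one A (0 : Ty A); rw [zero_add, wt_zero] at this; omega
  unfold pot clsTy
  simp only [wt_zero, wt_delta]
  rw [add_comm (1 : Ty A), wt_add_one, wt_delta]
  omega

omit [AddCommGroup A] in
/-- `ν` of the two residual representatives of potential `1`. [folklore] -/
theorem nu_residual (h3 : 3 ≤ Fintype.card A) (t : A) : nu A ((0 : Ty A), δ A t) = 1 ∧ nu A ((0 : Ty A), 1 + δ A t) = 0 := by
  unfold nu clsTy
  simp only [wt_zero, wt_delta]
  rw [add_comm (1 : Ty A), wt_add_one, wt_delta]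
  have e1 : (0 : ℕ) ≤ Fintype.card A / 2 := Nat.zero_le _
  have e2 : 1 ≤ Fintype.card A / 2 := by omega
  have e3 : ¬ (Fintype.card A - 1 ≤ Fintype.card A / 2) := by omega
  rw [Nat.zero_min, if_pos rfl, if_pos e1, if_pos e2, if_neg e3]
  exact ⟨by decide, by decide⟩

/-- **The three residual representatives lie in three distinct blocks** (`|A|` odd `≥ 3`). [folklore] -/
theorem three_residual_blocks (hA : Odd (Fintype.card A)) (h3 : 3 ≤ Fintype.card A) (t : A) :
    blk A ((0 : Ty A), (0 : Ty A)) ≠ blk A ((0 : Ty A), δ A t) ∧ blk A ((0 : Ty A), (0 : Ty A)) ≠ blk A ((0 : Ty A), 1 + δ A t) ∧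
      blk A ((0 : Ty A), δ A t) ≠ blk A ((0 : Ty A), 1 + δ A t) := by
  obtain ⟨p0, p1, p2⟩ := pot_residual A h3 t
  obtain ⟨n1, n2⟩ := nu_residual A h3 t
  refine ⟨fun h => ?_, fun h => ?_, fun h => ?_⟩
  · have := pot_eq_of_reach A ((blk_eq_blk_iff A _ _).mp h); omega
  · have := pot_eq_of_reach A ((blk_eq_blk_iff A _ _).mp h); omega
  · have := nu_eq_of_reach A hA p1 ((blk_eq_blk_iff A _ _).mp h)
    rw [n1, n2] at this
    exact one_ne_zero this

/-- **At most `β − 3` blocks are non-residual** (potential `≥ 2`). [folklore] -/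
theorem card_nonresidual_add_three_le (hA : Odd (Fintype.card A)) (h3 : 3 ≤ Fintype.card A) :
    (univ.filter fun B : Block A => 2 ≤ potB A B).card + 3 ≤ Fintype.card (Block A) := by
  haveI : Nonempty A := Fintype.card_pos_iff.mp (by omega)
  obtain ⟨t⟩ := (inferInstance : Nonempty A)
  obtain ⟨d1, d2, d3⟩ := three_residual_blocks A hA h3 t
  obtain ⟨p0, p1, p2⟩ := pot_residual A h3 t
  classical
  set R : Finset (Block A) := {blk A ((0 : Ty A), (0 : Ty A)), blk A ((0 : Ty A), δ A t), blk A ((0 : Ty A), 1 + δ A t)} with hR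
  have hRc : R.card = 3 := by
    rw [hR, Finset.card_insert_of_notMem (by simp [d1, d2]), Finset.card_pair d3]
  have hdisj : Disjoint (univ.filter fun B : Block A => 2 ≤ potB A B) R := by
    rw [Finset.disjoint_left]
    intro B hB hBR
    rw [Finset.mem_filter] at hB
    rw [hR, Finset.mem_insert, Finset.mem_insert, Finset.mem_singleton] at hBR
    rcases hBR with rfl | rfl | rfl
    · rw [potB_blk] at hB; omega
    · rw [potB_blk] at hB; omega
    · rw [potB_blk] at hB; omega
  have := Finset.card_le_univ ((univ.filter fun B : Block A => 2 ≤ potB A B) ∪ R)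
  rw [Finset.card_union_of_disjoint hdisj, hRc] at this
  exact this

end Summit.HodgeConjecture.CorCM.Census.DicyclicTwist
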